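import Literature.MathematicalPhysics.KineticTheory.HardSphereEuler
import Literature.MathematicalPhysics.KineticTheory.FouriersLaw
import Literature.MathematicalPhysics.StatisticalMechanics.Crystallization
import Literature.MathematicalPhysics.QuantumManyBody.BoseEinsteinCondensation
import HarnessLib

/-!
# AtomisticToContinuum / FouriersLaw — sub-problem statement (D-0017)

Moved out of `Summits/AtomisticToContinuum/Statement.lean` with the declaration text unchanged.
-/

/-- Conjunct `FouriersLaw` of `AtomisticToContinuum`: the Literature statement
`Literature.MathematicalPhysics.KineticTheory.HeatConduction.FouriersLaw` (`Literature/MathematicalPhysics/KineticTheory/FouriersLaw.lean`),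
imported not restated — for the pinned anharmonic chain between Langevin baths, the conductivity
`κ(T) = lim_N N · lim_{δT→0} J_N/δT` exists, positive and finite.
[cite: BonettoLebowitzReyBellet2000, §5.3 (33)] [problem: hilbert6] -/
abbrev FouriersLaw : Prop := Literature.MathematicalPhysics.KineticTheory.HeatConduction.FouriersLaw
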